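import Summits.PneNP.PneNP.Theses.ExpanderLinearGenerators

/-!
# PneNP / ExpanderLinearGenerators — glue `ModPHardGivesDepthHard` (stmt-PneNP-11447)

Route `PneNP/ExpanderLinearGenerators`, item stmt-PneNP-11447 (`ModPHardGivesDepthHard`, support,
rank 9): the AC⁰[p]-Frege rung (crux 4, `LinearGeneratorModPFregeHard`) sits above the AC⁰-Frege
rung (crux 3, `LinearGeneratorDepthFregeHard`).

Proof: instantiate crux 4 at the odd prime `p = 3`; a depth-`d` `textbookFrege` proof `π` of
`¬ (sumEncoding 1 E)` is, read in the extended language, a depth-`d` `textbookFrege(MOD₃)` proof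
`π.map PropFormMod.ofPropForm` of `ofPropForm (¬ (sumEncoding 1 E))`
(`FregeSystem.IsDepthProofOf.isModDepthProofOf_map`, Buss et al. 1997, Def. 1.1: `F(MOD_a)`
extends `F`), and the embedding preserves size (`modProofSize_map_ofPropForm`). Hence the
`2^(n^ε)` lower bound for `F_d(MOD₃)` proofs transfers verbatim, with the same `ε` and `N`.

References: S. Buss, R. Impagliazzo, J. Krajíček, P. Pudlák, A. A. Razborov, J. Sgall, *Proof
complexity in algebraic systems and bounded depth Frege systems with modular counting*,
Comput. Complexity 6 (1996/97), Def. 1.1 [doi:10.1007/bf01294258]; S. Cook, R. Reckhow, *The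
relative efficiency of propositional proof systems*, JSL 44 (1979), §2 [CookReckhow1979].
-/

set_option linter.dupNamespace false -- `Summit.PneNP.PneNP.…`: summit = sub-problem (D-0017)

namespace Summit.PneNP.PneNP.Theorems

open Literature.Computability.MetaComplexity

/-- **Glue crux 4 → crux 3 of route ExpanderLinearGenerators** (item stmt-PneNP-11447):
`LinearGeneratorModPFregeHard → LinearGeneratorDepthFregeHard`. Instantiate the AC⁰[p] rung at
`p = 3`; a depth-`d` `textbookFrege` proof embeds as a depth-`d` `textbookFrege(MOD₃)` proof of the
same size (`FregeSystem.IsDepthProofOf.isModDepthProofOf_map`, `modProofSize_map_ofPropForm`), so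
the exponential lower bound descends with the same `ε`, `N`. [doi:10.1007/bf01294258, Def. 1.1;
CookReckhow1979, §2] -/
theorem expanderLinearGenerators_modPHardGivesDepthHard_proof :
    Summit.PneNP.PneNP.Theses.ExpanderLinearGenerators.ModPHardGivesDepthHard := by
  unfold Summit.PneNP.PneNP.Theses.ExpanderLinearGenerators.ModPHardGivesDepthHard
  intro hMod ℓ d δ hℓ hδ hδ1
  obtain ⟨ε, hε, N, hN⟩ := hMod 3 Nat.prime_three (by decide) ℓ d δ hℓ hδ hδ1
  refine ⟨ε, hε, N, fun n hn m E hsp hexp hunsat π hπ => ?_⟩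
  have h := hN n hn m E hsp hexp hunsat (π.map PropFormMod.ofPropForm)
    (FregeSystem.IsDepthProofOf.isModDepthProofOf_map hπ)
  rwa [modProofSize_map_ofPropForm] at h

end Summit.PneNP.PneNP.Theorems
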